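import Literature.NumberTheory.EllipticCurves.IsogenyDualInseparableProofs
import Literature.NumberTheory.EllipticCurves.DivisionPolynomialTorsionProofs
import Literature.NumberTheory.EllipticCurves.SelmerProofs
import Mathlib.FieldTheory.PurelyInseparable.PerfectClosure
import Mathlib.Algebra.Polynomial.Expand
import HarnessLib

/-!
# `[p]` is inseparable; purely inseparable points are `p`-power torsion modulo rational points

Topic `NumberTheory/EllipticCurves` (trunk T-ELLARITH). A *proofs* file (theorems only: no
definition, no named fact; D-0014/D-0026), written by the provefact seat (approach B) of
`Literature.NumberTheory.EllipticCurves.analyticRank_eq_iff_finite_sha` (bsd.S33, the Tate–Milne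
theorem over global function fields) as a route-independent prerequisite of that fact: its
statement mixes `rank_ℤ E(F)` (`WeierstrassCurve.mordellWeilRank`, the `F`-rational points) with
`Ш(E/F) ⊆ H¹(Γ_F, E(F̄))` (`FunctionField.sha`, geometric points over `F̄ = AlgebraicClosure F`),
and over the **imperfect** global function field `F` the fixed points `E(F̄)^{Γ_F}` are the points
over the perfect closure `F^{perf}`, not `E(F)`. Every descent lemma of the tree
(`fixedPoints_eq_range_map_holds`, `exists_toGeomPoints_eq_of_forall_smul_eq`,
`kummerMapTorsion_ker`, `mem_range_kummerMapTorsion_of_torsionH1ToH1_eq_zero`,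
`Isogeny.exists_pointHom`) accordingly assumes `[PerfectField K]`. This file supplies the bridge:

* `WeierstrassCurve.card_roots_Φ_sub_C_mul_ΨSq_le` — in characteristic `p`, for every `c ∈ K̄`
  the polynomial `Φ_p − c·ΨSq_p` (degree `p²`) has at most `#E[p]` distinct roots (its roots are
  the abscissae of the points `Q` with `x(pQ) = c`, a coset of `E[p]` up to sign);
* `WeierstrassCurve.wronskian_Φ_ΨSq_baseChange_eq_zero`, `WeierstrassCurve.derivative_Φ_mul_ΨSq_eq`
  (**`[p]` is inseparable**): the Wronskian `Φ_p' ΨSq_p − Φ_p ΨSq_p'` vanishes, i.e. the rational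
  function `x ∘ [p] = Φ_p/ΨSq_p` has zero derivative — because `#E[p] < p²` (the tree's
  `natCard_geomTorsion_lt_sq`, Silverman *AEC* Cor. III.6.4(c) in crude form) forces a repeated
  root of `Φ_p − c·ΨSq_p` for *every* `c`, and `K̄` is infinite; hence
  `derivative_Φ_eq_zero_of_charP`, `derivative_ΨSq_eq_zero_of_charP` (by coprimality,
  Exercise 3.7(c), the tree's `isCoprime_Φ_ΨSq_holds`) and `exists_Φ_eq_expand`,
  `exists_ΨSq_eq_expand`: **`Φ_p, ΨSq_p ∈ K[X^p]`** (Mathlib's `expand_contract`). This is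
  Silverman, *AEC*, Cor. III.5.5 ("`[p]` is inseparable"; there via the invariant differential
  `[m]^* ω = mω`, absent from Mathlib), obtained here by counting;
* `WeierstrassCurve.zsmul_expChar_descends`,
  `WeierstrassCurve.exists_pow_smul_eq_map_of_pow_mem` — if the coordinates of `Q ∈ E(L)`
  (`L ⊇ K`) have `p^n`-th powers in `K`, then `p^m Q ∈ E(K)` for some `m` (induction on `n`:
  `x(pQ) = A(x^p)/B(x^p)` with `A, B ∈ K[X]`, and `y(pQ)` is recovered from the Weierstrass
  equation, a quadratic over the field `K^{1/p^{n-1}}`, except for a `2`-torsion escape in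
  characteristic `2`);
* `WeierstrassCurve.exists_pow_expChar_smul_eq_toGeomPoints_of_forall_smul_eq` — **Galois
  descent up to `p`-power torsion over an arbitrary field**: a `Γ_K`-fixed point `Q ∈ E(K̄)` has
  `p^m Q ∈ E(K)` for some `m` (`p` the exponential characteristic; `m = 0` for `K` perfect),
  since `Γ_K`-fixed elements of `K̄` lie in the perfect closure;
* consequences for `n` invertible in `K` (no perfectness hypothesis):
  `exists_toGeomPoints_eq_of_forall_smul_eq_of_zsmul_eq` (a fixed `Q` with `nQ ∈ E(K)` lies in
  `E(K)`), `kummerMapTorsion_ker_of_ne_zero` (the Kummer map `E(K) → H¹(K, E[n])` has kernel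
  exactly `nE(K)`) and `mem_range_kummerMapTorsion_of_torsionH1ToH1_eq_zero_of_ne_zero` (its
  image is `ker (H¹(K, E[n]) → H¹(K, E))`), i.e. the Kummer sequence
  `0 → E(K)/nE(K) → H¹(K, E[n]) → H¹(K, E)[n] → 0` of Silverman VIII.§2 over **any** field for
  `n` invertible in `K` (with the tree's `range_torsionH1ToH1_eq_torsionBy_holds` for the last
  map) — the form needed over global function fields (Milne, *ADT*, I.§6; Ulmer (2011),
  Lecture 1, §5 and (11.1)).

## References

* [SilvermanAEC2009] J. H. Silverman, *The Arithmetic of Elliptic Curves*, 2nd ed., GTM 106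
  (2009): Cor. II.2.12, Cor. III.5.5 and proof of Thm. III.6.1 Case 2 (`[p]` is inseparable),
  Cor. III.6.4, Exercise 3.7 (b)–(f), VIII.§1–§2 (Galois descent and the Kummer sequence).
* [MilneADT2006] J. S. Milne, *Arithmetic Duality Theorems*, 2nd ed. (2006), I.§6 (the Kummer
  and descent sequences over global fields, function fields included, `m` prime to `char K`).
* [Ulmer2011ParkCity] D. Ulmer, *Elliptic curves over function fields*, IAS/Park City Math. Ser.
  18 (2011), Lecture 1, §5 (Selmer groups for `ℓ ≠ p`) and §11, (11.1).

## Design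

`noncomputable section`, `open scoped Classical`, one universe `u` (`K : Type u`, as `geomPoints`,
`toGeomPoints`, `kummerMapTorsion` require); theorems only, deliberate dot-notation extensions of
Mathlib's `WeierstrassCurve`. The descent step is proved for the points over an arbitrary
extension `L ⊇ K` (no local notation, no auxiliary definition): membership in `K^{1/p^n} ⊆ L` is
the predicate `∃ k, algebraMap K L k = z ^ p ^ n`, and inside proofs the subfield
`(algebraMap K L).fieldRange.comap (iterateFrobenius L p n)` is used. The perfect-closure
lemma "`Γ_K`-fixed ⟹ purely inseparable" exists in the tree as
`mem_perfectClosure_of_forall_algEquiv_apply_eq` (namespace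
`Literature.NumberTheory.EllipticCurves.FunctionField`, file `FunctionFieldUnramifiedProofs`);
it is re-proved here privately (15 lines) so that this field-general file does not import the
function-field hierarchy.
-/

noncomputable section

open scoped Classical
open Polynomial Literature.NumberTheory.EllipticCurves Literature.NumberTheory.GaloisRepresentations

universe u

namespace WeierstrassCurve

variable {K : Type u} [Field K] (W : WeierstrassCurve K) [W.IsElliptic]

/-! ## Fibres of `x ∘ [p]` in characteristic `p` -/

/-- In characteristic `p`, for every `c ∈ K̄` the polynomial `Φ_p − c·ΨSq_p ∈ K̄[X]` has at most
`#E[p]` distinct roots: a root `a` is the abscissa of a point `Q = (a, b)` with `x(pQ) = c`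
(`x(pQ)·ΨSq_p(a) = Φ_p(a)`, Silverman *AEC* Exercise 3.7(d), tree `mul_eval_ΨSq_of_zsmul_eq`;
`ΨSq_p(a) ≠ 0` by Exercise 3.7(c)), i.e. `pQ = ±Q₀` for a fixed `Q₀`, and after adjusting signs
`Q − Q'` runs injectively into `E[p]`. [cite: SilvermanAEC2009, Exercise 3.7(c),(d)] -/
theorem card_roots_Φ_sub_C_mul_ΨSq_le {p : ℕ} (hp : p.Prime) (c : AlgebraicClosure K) :
    ((W.baseChange (AlgebraicClosure K)).Φ p -
        C c * (W.baseChange (AlgebraicClosure K)).ΨSq p).roots.toFinset.card ≤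
      Nat.card (geomTorsion W (p : ℤ)) := by
  set V := W.baseChange (AlgebraicClosure K) with hV
  set f := V.Φ p - C c * V.ΨSq p with hf
  have hp0 : (p : ℤ) ≠ 0 := by exact_mod_cast hp.ne_zero
  set R := f.roots.toFinset with hR
  by_cases hf0 : f = 0
  · have : R = ∅ := by rw [hR, hf0, roots_zero, Multiset.toFinset_zero]
    rw [this, Finset.card_empty]
    exact Nat.zero_le _
  choose y₀ hy₀ using V.exists_equation
  have hns : ∀ a, V.toAffine.Nonsingular a (y₀ a) := fun a =>
    (Affine.equation_iff_nonsingular (W := V.toAffine)).mp (hy₀ a)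
  -- evaluation at a root
  have hroot : ∀ a ∈ R, (V.Φ p).eval a = c * (V.ΨSq p).eval a := by
    intro a ha
    rw [hR, Multiset.mem_toFinset, mem_roots hf0, IsRoot.def, hf, eval_sub, eval_mul, eval_C,
      sub_eq_zero] at ha
    exact ha
  have hΨ : ∀ a ∈ R, (V.ΨSq p).eval a ≠ 0 := fun a ha h0 =>
    eval_Φ_ne_zero_of_eval_ΨSq_eq_zero V (hns a) h0 (by rw [hroot a ha, h0, mul_zero])
  -- the point over `a` and its multiple by `p`
  set Pt : AlgebraicClosure K → W.geomPoints :=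
    fun a => (Affine.Point.some a (y₀ a) (hns a) : W.geomPoints) with hPt
  have hne : ∀ a ∈ R, (p : ℤ) • Pt a ≠ 0 := fun a ha h0 =>
    hΨ a ha ((zsmul_some_eq_zero_iff_eval_ΨSq V (hns a) p).mp h0)
  have hmul : ∀ a ∈ R, ∃ (y' : AlgebraicClosure K) (h' : V.toAffine.Nonsingular c y'),
      (p : ℤ) • Pt a = (Affine.Point.some c y' h' : W.geomPoints) := by
    intro a ha
    obtain ⟨x', y', h', e⟩ := geomPoints.exists_eq_some (hne a ha)
    have hx : x' * (V.ΨSq p).eval a = (V.Φ p).eval a := mul_eval_ΨSq_of_zsmul_eq V (hns a) p h' e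
    rw [hroot a ha] at hx
    have hx' : x' = c := mul_right_cancel₀ (hΨ a ha) hx
    subst hx'
    exact ⟨y', h', e⟩
  by_cases hRe : R = ∅
  · rw [hRe, Finset.card_empty]; exact Nat.zero_le _
  obtain ⟨a₀, ha₀⟩ := Finset.nonempty_iff_ne_empty.mpr hRe
  obtain ⟨y₀', h₀', e₀⟩ := hmul a₀ ha₀
  set Q₀ : W.geomPoints := (Affine.Point.some c y₀' h₀' : W.geomPoints) with hQ₀
  -- every `p • Pt a` is `± Q₀`
  have hpm : ∀ a ∈ R, (p : ℤ) • Pt a = Q₀ ∨ (p : ℤ) • Pt a = -Q₀ := by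
    intro a ha
    obtain ⟨y', h', e⟩ := hmul a ha
    rcases (equation_iff_eq_or_eq_negY V h₀'.left y').mp h'.left with hy | hy
    · left
      rw [e, hQ₀]
      subst hy
      rfl
    · right
      rw [e, hQ₀]
      subst hy
      rfl
  -- sign-adjusted section `g` with `p • g a = Q₀` and `x(g a) = a`
  set g : AlgebraicClosure K → W.geomPoints :=
    fun a => if (p : ℤ) • Pt a = Q₀ then Pt a else -Pt a with hg
  have hgQ : ∀ a ∈ R, (p : ℤ) • g a = Q₀ := by
    intro a ha
    by_cases h : (p : ℤ) • Pt a = Q₀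
    · simp only [hg, h, if_true]
    · simp only [hg, h, if_false, smul_neg]
      rcases hpm a ha with h' | h'
      · exact absurd h' h
      · rw [h', neg_neg]
  have hgx : ∀ a, geomPoints.xy (g a) 0 = a := by
    intro a
    by_cases h : (p : ℤ) • Pt a = Q₀
    · rw [show g a = Pt a from if_pos h,
        show Pt a = (Affine.Point.some a (y₀ a) (hns a) : W.geomPoints) from rfl,
        geomPoints.xy_some]
      rfl
    · rw [show g a = -Pt a from if_neg h,
        show -Pt a = (Affine.Point.some a (V.toAffine.negY a (y₀ a))
          ((Affine.nonsingular_neg ..).mpr (hns a)) : W.geomPoints) from rfl,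
        geomPoints.xy_some]
      rfl
  -- `a ↦ g a - g a₀` maps `R` injectively into `E[p]`
  set T : Set W.geomPoints := (geomTorsion W (p : ℤ) : Set W.geomPoints) with hT
  have hTfin : T.Finite := finite_geomTorsion W hp0
  have hmaps : ∀ a ∈ (R : Set (AlgebraicClosure K)), g a - g a₀ ∈ T := by
    intro a ha
    rw [Finset.mem_coe] at ha
    change g a - g a₀ ∈ geomTorsion W (p : ℤ)
    rw [mem_torsionBy_iff, smul_sub, hgQ a ha, hgQ a₀ ha₀, sub_self]
  have hinj : Set.InjOn (fun a => g a - g a₀) (R : Set (AlgebraicClosure K)) := by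
    intro a _ b _ hab
    have : g a = g b := sub_left_injective hab
    rw [← hgx a, ← hgx b, this]
  have h := Set.ncard_le_ncard_of_injOn _ hmaps hinj hTfin
  rwa [Set.ncard_coe_finset, hT, ← Nat.card_coe_set_eq, SetLike.coe_sort_coe] at h

/-! ## `[p]` is inseparable: the Wronskian of `Φ_p` and `ΨSq_p` vanishes -/

/-- **`[p]` is inseparable in characteristic `p`**, over `K̄`: the Wronskian
`Φ_p' ΨSq_p − Φ_p ΨSq_p'` of the base change to `K̄ = AlgebraicClosure K` is zero. Otherwise it
has finitely many roots; but for *every* `c ∈ K̄` the polynomial `Φ_p − c·ΨSq_p`, of degree `p²`,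
has at most `#E[p] < p²` distinct roots (`card_roots_Φ_sub_C_mul_ΨSq_le` and the tree's
`natCard_geomTorsion_lt_sq`, Silverman *AEC* Cor. III.6.4(c)), hence a repeated root `α_c`, which
is a root of the Wronskian determining `c = Φ_p(α_c)/ΨSq_p(α_c)` — infinitely many roots. This
replaces Silverman's `[p]^* ω = p ω = 0` (Cor. III.5.5). [cite: SilvermanAEC2009, Cor. III.5.5] -/
theorem wronskian_Φ_ΨSq_baseChange_eq_zero {p : ℕ} (hp : p.Prime) (hpK : (p : K) = 0) :
    derivative ((W.baseChange (AlgebraicClosure K)).Φ p) *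
        (W.baseChange (AlgebraicClosure K)).ΨSq p -
      (W.baseChange (AlgebraicClosure K)).Φ p *
        derivative ((W.baseChange (AlgebraicClosure K)).ΨSq p) = 0 := by
  set V := W.baseChange (AlgebraicClosure K) with hV
  by_contra hW
  set Wr := derivative (V.Φ p) * V.ΨSq p - V.Φ p * derivative (V.ΨSq p) with hWr
  choose y₀ hy₀ using V.exists_equation
  have hns : ∀ a, V.toAffine.Nonsingular a (y₀ a) := fun a =>
    (Affine.equation_iff_nonsingular (W := V.toAffine)).mp (hy₀ a)
  have hdegΦ : (V.Φ p).natDegree = p ^ 2 := by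
    rw [natDegree_Φ, Int.natAbs_natCast]
  have hlt := natCard_geomTorsion_lt_sq W hp hpK
  -- for every `c`, a repeated root of `Φ_p - c ΨSq_p`, which is a root of the Wronskian
  have key : ∀ c : AlgebraicClosure K, ∃ α : AlgebraicClosure K, Wr.IsRoot α ∧
      (V.ΨSq p).eval α ≠ 0 ∧ (V.Φ p).eval α = c * (V.ΨSq p).eval α := by
    intro c
    set f := V.Φ p - C c * V.ΨSq p with hf
    have hdegΨ : (C c * V.ΨSq p).natDegree < (V.Φ p).natDegree := by
      rw [hdegΦ]
      refine (natDegree_C_mul_le _ _).trans_lt ((natDegree_ΨSq_le _ _).trans_lt ?_)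
      rw [Int.natAbs_natCast]
      exact Nat.sub_lt (pow_pos hp.pos 2) Nat.one_pos
    have hfdeg : f.natDegree = p ^ 2 := by
      rw [hf, natDegree_sub_eq_left_of_natDegree_lt hdegΨ, hdegΦ]
    have hf0 : f ≠ 0 := by
      intro h
      rw [h, natDegree_zero] at hfdeg
      exact (pow_pos hp.pos 2).ne hfdeg
    have hnsep : ¬ f.Separable := by
      intro hsep
      have hcard : f.roots.toFinset.card = p ^ 2 := by
        rw [Multiset.toFinset_card_of_nodup (nodup_roots hsep), IsAlgClosed.card_roots_eq_natDegree,
          hfdeg]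
      have hle := card_roots_Φ_sub_C_mul_ΨSq_le W hp c
      rw [← hf, hcard] at hle
      omega
    rw [separable_def,
      Polynomial.isCoprime_iff_aeval_ne_zero_of_isAlgClosed (k := AlgebraicClosure K)
        (K := AlgebraicClosure K)] at hnsep
    push Not at hnsep
    obtain ⟨α, h1, h2⟩ := hnsep
    rw [coe_aeval_eq_eval] at h1 h2
    rw [hf, eval_sub, eval_mul, eval_C, sub_eq_zero] at h1
    rw [hf, derivative_sub, derivative_C_mul, eval_sub, eval_mul, eval_C, sub_eq_zero] at h2
    have hΨα : (V.ΨSq p).eval α ≠ 0 := fun h0 =>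
      eval_Φ_ne_zero_of_eval_ΨSq_eq_zero V (hns α) h0 (by rw [h1, h0, mul_zero])
    refine ⟨α, ?_, hΨα, h1⟩
    rw [IsRoot.def, hWr, eval_sub, eval_mul, eval_mul, h1, h2]
    ring
  choose α hα using key
  have hinj : Function.Injective α := by
    intro c₁ c₂ h
    have e₁ := (hα c₁).2.2
    have e₂ := (hα c₂).2.2
    rw [h] at e₁
    exact mul_right_cancel₀ (hα c₂).2.1 (e₁.symm.trans e₂)
  have hsub : Set.range α ⊆ (Wr.roots.toFinset : Set (AlgebraicClosure K)) := by
    rintro _ ⟨c, rfl⟩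
    rw [Finset.mem_coe, Multiset.mem_toFinset, mem_roots hW]
    exact (hα c).1
  exact (Set.infinite_range_of_injective hinj) ((Wr.roots.toFinset.finite_toSet).subset hsub)

/-- **`[p]` is inseparable** (Silverman, *AEC*, Cor. III.5.5), in the form: in characteristic `p`
the Wronskian `Φ_p' ΨSq_p − Φ_p ΨSq_p'` of the division polynomials of an elliptic curve
vanishes, i.e. `(Φ_p/ΨSq_p)' = 0` — descended from `K̄` (`wronskian_Φ_ΨSq_baseChange_eq_zero`)
along the injection `K[X] → K̄[X]`. [cite: SilvermanAEC2009, Cor. III.5.5] -/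
theorem derivative_Φ_mul_ΨSq_eq {p : ℕ} (hp : p.Prime) (hpK : (p : K) = 0) :
    derivative (W.Φ p) * W.ΨSq p = W.Φ p * derivative (W.ΨSq p) := by
  have h := wronskian_Φ_ΨSq_baseChange_eq_zero W hp hpK
  have e₁ : (W.baseChange (AlgebraicClosure K)).Φ p = (W.Φ p).map (algebraMap K _) :=
    W.map_Φ (algebraMap K (AlgebraicClosure K)) p
  have e₂ : (W.baseChange (AlgebraicClosure K)).ΨSq p = (W.ΨSq p).map (algebraMap K _) :=
    W.map_ΨSq (algebraMap K (AlgebraicClosure K)) p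
  rw [sub_eq_zero, e₁, e₂, derivative_map, derivative_map, ← Polynomial.map_mul,
    ← Polynomial.map_mul] at h
  exact Polynomial.map_injective _ (algebraMap K (AlgebraicClosure K)).injective h

/-- In characteristic `p`, **`Φ_p' = 0`**: from `Φ_p' ΨSq_p = Φ_p ΨSq_p'` and the coprimality of
`Φ_p` and `ΨSq_p` (Silverman, *AEC*, Exercise 3.7(c); tree `isCoprime_Φ_ΨSq_holds`), `Φ_p`
divides `Φ_p'`, of smaller degree. [cite: SilvermanAEC2009, Cor. III.5.5 and Exercise 3.7(c)] -/
theorem derivative_Φ_eq_zero_of_charP {p : ℕ} (hp : p.Prime) (hpK : (p : K) = 0) :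
    derivative (W.Φ p) = 0 := by
  have hcop : IsCoprime (W.Φ p) (W.ΨSq p) := isCoprime_Φ_ΨSq_holds (V := W) p
  have h := derivative_Φ_mul_ΨSq_eq W hp hpK
  have hdvd : W.Φ p ∣ derivative (W.Φ p) :=
    hcop.dvd_of_dvd_mul_right ⟨derivative (W.ΨSq p), by rw [h]⟩
  refine eq_zero_of_dvd_of_natDegree_lt hdvd (natDegree_derivative_lt ?_)
  rw [natDegree_Φ, Int.natAbs_natCast]
  exact (pow_pos hp.pos 2).ne'

/-- In characteristic `p`, **`ΨSq_p' = 0`** (same argument with the roles exchanged).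
[cite: SilvermanAEC2009, Cor. III.5.5 and Exercise 3.7(c)] -/
theorem derivative_ΨSq_eq_zero_of_charP {p : ℕ} (hp : p.Prime) (hpK : (p : K) = 0) :
    derivative (W.ΨSq p) = 0 := by
  have hcop : IsCoprime (W.Φ p) (W.ΨSq p) := isCoprime_Φ_ΨSq_holds (V := W) p
  have h := derivative_Φ_mul_ΨSq_eq W hp hpK
  have hdvd : W.ΨSq p ∣ derivative (W.ΨSq p) :=
    hcop.symm.dvd_of_dvd_mul_right ⟨derivative (W.Φ p), by linear_combination -h⟩
  by_cases hdeg : (W.ΨSq p).natDegree = 0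
  · exact derivative_of_natDegree_zero hdeg
  · exact eq_zero_of_dvd_of_natDegree_lt hdvd (natDegree_derivative_lt hdeg)

/-- In characteristic `p`, **`Φ_p ∈ K[X^p]`**: `Φ_p = A(X^p)` for some `A ∈ K[X]` (a polynomial
with zero derivative is a polynomial in `X^p`, Mathlib `expand_contract`).
[cite: SilvermanAEC2009, Cor. II.2.12 and Cor. III.5.5] -/
theorem exists_Φ_eq_expand {p : ℕ} (hp : p.Prime) [CharP K p] :
    ∃ A : K[X], W.Φ p = expand K p A :=
  ⟨contract p (W.Φ p),
    (expand_contract p (derivative_Φ_eq_zero_of_charP W hp (CharP.cast_eq_zero K p))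
      hp.ne_zero).symm⟩

/-- In characteristic `p`, **`ΨSq_p ∈ K[X^p]`**: `ΨSq_p = B(X^p)` for some `B ∈ K[X]`.
[cite: SilvermanAEC2009, Cor. II.2.12 and Cor. III.5.5] -/
theorem exists_ΨSq_eq_expand {p : ℕ} (hp : p.Prime) [CharP K p] :
    ∃ B : K[X], W.ΨSq p = expand K p B :=
  ⟨contract p (W.ΨSq p),
    (expand_contract p (derivative_ΨSq_eq_zero_of_charP W hp (CharP.cast_eq_zero K p))
      hp.ne_zero).symm⟩

/-! ## Points with purely inseparable coordinates -/

section Descent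


/-- The Weierstrass equation solved for the `y`-terms: on the curve,
`y² + (a₁x + a₃) y = x³ + a₂x² + a₄x + a₆`. [folklore] -/
private theorem equation_quadratic {L : Type u} [Field L] (V : WeierstrassCurve L) {x y : L}
    (h : V.toAffine.Equation x y) :
    y ^ 2 + (V.a₁ * x + V.a₃) * y = x ^ 3 + V.a₂ * x ^ 2 + V.a₄ * x + V.a₆ := by
  rw [Affine.equation_iff] at h
  linear_combination h

/-- In a field, an element `w` with `w² ∈ S` and `w^p ∈ S` for a subfield `S` and an odd `p` lies
in `S` (`w = w^p / (w²)^k`, `p = 2k + 1`). [folklore] -/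
private theorem mem_of_sq_mem_of_pow_mem {L : Type u} [Field L] (S : Subfield L) {p : ℕ}
    (hodd : Odd p) {w : L} (h2 : w ^ 2 ∈ S) (hpw : w ^ p ∈ S) : w ∈ S := by
  by_cases hw : w = 0
  · rw [hw]; exact zero_mem S
  obtain ⟨k, rfl⟩ := hodd
  have hk : w = w ^ (2 * k + 1) / (w ^ 2) ^ k := by
    rw [← pow_mul, pow_succ, mul_div_cancel_left₀ _ (pow_ne_zero _ hw)]
  rw [hk]
  exact div_mem hpw (pow_mem h2 k)

/-- **The `x`- and `y`-coordinates of `pQ` are one Frobenius-step more rational than those of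
`Q`.** Let `char K = p`, let `L ⊇ K` be a field extension and let `Q = (x, y) ∈ E(L)` have
`x^{p^{n+1}}, y^{p^{n+1}} ∈ K`. Then either `pQ = O`, or `pQ = (x', y')` with `x'^{p^n} ∈ K` and —
unless `p = 2` and `pQ` is a point of order `2`, in which case `p (pQ) = O` — also
`y'^{p^n} ∈ K`. Indeed `x' = Φ_p(x)/ΨSq_p(x) = A(x^p)/B(x^p)` with `A, B ∈ K[X]`
(`exists_Φ_eq_expand`, `exists_ΨSq_eq_expand`: `[p]` is inseparable), `y'` lies in the field
`K^{1/p^{n+1}} ⊆ L` (the group law is defined over it) so `y'^p ∈ K^{1/p^n} ∋ x'`, and the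
Weierstrass equation, a quadratic in `y'` over `K^{1/p^n}`, forces `y' ∈ K^{1/p^n}` (`p` odd:
complete the square; `p = 2`: `(a₁x' + a₃) y' ∈ K^{1/p^n}`, and `a₁x' + a₃ = 0` means
`pQ = -pQ`). [cite: SilvermanAEC2009, Cor. II.2.12 and Cor. III.5.5] -/
theorem zsmul_expChar_descends {p : ℕ} (hp : p.Prime) [CharP K p] (L : Type u) [Field L]
    [Algebra K L] (n : ℕ) {x y : L} (h : (W⁄L).toAffine.Nonsingular x y)
    (hx : ∃ k : K, algebraMap K L k = x ^ p ^ (n + 1))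
    (hy : ∃ k : K, algebraMap K L k = y ^ p ^ (n + 1)) :
    (p : ℤ) • Affine.Point.some x y h = 0 ∨
      ∃ (x' y' : L) (h' : (W⁄L).toAffine.Nonsingular x' y'),
        (p : ℤ) • Affine.Point.some x y h = Affine.Point.some x' y' h' ∧
        (∃ k : K, algebraMap K L k = x' ^ p ^ n) ∧
        ((∃ k : K, algebraMap K L k = y' ^ p ^ n) ∨
          (p : ℤ) • Affine.Point.some x' y' h' = 0) := by
  haveI : Fact p.Prime := ⟨hp⟩
  haveI : CharP L p := charP_of_injective_algebraMap (algebraMap K L).injective p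
  haveI : ExpChar L p := ExpChar.prime hp
  -- the subfields `K^{1/p^m} ⊆ L`
  set S : ℕ → Subfield L := fun m =>
    (algebraMap K L).fieldRange.comap (iterateFrobenius L p m) with hS
  have memS : ∀ m z, z ∈ S m ↔ ∃ k : K, algebraMap K L k = z ^ p ^ m := by
    intro m z
    simp only [hS, Subfield.mem_comap, iterateFrobenius_def, RingHom.mem_fieldRange]
  have algS : ∀ m (k : K), algebraMap K L k ∈ S m := fun m k =>
    (memS m _).mpr ⟨k ^ p ^ m, by rw [map_pow]⟩
  have powS : ∀ m z, z ∈ S (m + 1) → z ^ p ∈ S m := by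
    intro m z hz
    obtain ⟨k, hk⟩ := (memS _ _).mp hz
    exact (memS _ _).mpr ⟨k, by rw [hk, ← pow_mul, ← pow_succ']⟩
  have evalS : ∀ m (g : K[X]) z, z ∈ S m → (g.map (algebraMap K L)).eval z ∈ S m := by
    intro m g z hz
    induction g using Polynomial.induction_on' with
    | add f g hf hg => rw [Polynomial.map_add, eval_add]; exact add_mem hf hg
    | monomial k a =>
      rw [Polynomial.map_monomial, eval_monomial]
      exact mul_mem (algS m a) (pow_mem hz k)
  rcases e : (p : ℤ) • Affine.Point.some x y h with _ | ⟨x', y', h'⟩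
  · exact Or.inl rfl
  right
  have h0 : (p : ℤ) • Affine.Point.some x y h ≠ 0 := by
    rw [e]; exact Affine.Point.some_ne_zero h'
  -- (i) `x' ∈ K^{1/p^n}` by the inseparability of `[p]`
  have hx'S : x' ∈ S n := by
    obtain ⟨A, hA⟩ := exists_Φ_eq_expand W hp
    obtain ⟨B, hB⟩ := exists_ΨSq_eq_expand W hp
    have hxΨ : x' * ((W⁄L).ΨSq p).eval x = ((W⁄L).Φ p).eval x :=
      mul_eval_ΨSq_of_zsmul_eq (W⁄L) h p h' e
    have hΨ0 : ((W⁄L).ΨSq p).eval x ≠ 0 := fun h0' =>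
      h0 ((zsmul_some_eq_zero_iff_eval_ΨSq (W⁄L) h p).mpr h0')
    have eΦ : ((W⁄L).Φ p).eval x = (A.map (algebraMap K L)).eval (x ^ p) := by
      rw [show (W⁄L).Φ p = (W.Φ p).map (algebraMap K L) from W.map_Φ (algebraMap K L) p, hA,
        map_expand, expand_eval]
    have eΨ : ((W⁄L).ΨSq p).eval x = (B.map (algebraMap K L)).eval (x ^ p) := by
      rw [show (W⁄L).ΨSq p = (W.ΨSq p).map (algebraMap K L) from W.map_ΨSq (algebraMap K L) p,
        hB, map_expand, expand_eval]
    have hx' :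
        x' = (A.map (algebraMap K L)).eval (x ^ p) / (B.map (algebraMap K L)).eval (x ^ p) := by
      rw [← eΦ, ← eΨ, eq_div_iff hΨ0, hxΨ]
    have hxp : x ^ p ∈ S n := powS n x ((memS _ _).mpr hx)
    rw [hx']
    exact div_mem (evalS n A _ hxp) (evalS n B _ hxp)
  -- (ii) `y' ∈ K^{1/p^{n+1}}`: the group law is defined over that field
  have hy'S : y' ∈ S (n + 1) := by
    set T : IntermediateField K L := (S (n + 1)).toIntermediateField (algS (n + 1)) with hT
    have hxT : x ∈ T := (memS _ _).mpr hx
    have hyT : y ∈ T := (memS _ _).mpr hy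
    have hTns : (W⁄T).toAffine.Nonsingular ⟨x, hxT⟩ ⟨y, hyT⟩ :=
      (Affine.baseChange_nonsingular (W := W) (f := T.val) (RingHom.injective _)
        ⟨x, hxT⟩ ⟨y, hyT⟩).mp h
    set PT : (W⁄T).toAffine.Point := Affine.Point.some _ _ hTns with hPT
    have e' : Affine.Point.map T.val ((p : ℤ) • PT) = Affine.Point.some x' y' h' := by
      rw [map_zsmul]
      exact e
    rcases hP : (p : ℤ) • PT with _ | ⟨x'', y'', h''⟩
    · rw [hP] at e'
      exact absurd e'.symm (Affine.Point.some_ne_zero h')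
    · rw [hP, Affine.Point.map_some] at e'
      obtain ⟨-, ey⟩ := Affine.Point.some.inj e'
      rw [← ey]
      exact y''.2
  have hy'p : y' ^ p ∈ S n := powS n y' hy'S
  refine ⟨x', y', h', rfl, (memS n x').mp hx'S, ?_⟩
  -- (iii) the Weierstrass equation as a quadratic in `y'` over `K^{1/p^n}`
  have hquad := equation_quadratic (W⁄L) h'.left
  set u := (W⁄L).a₁ * x' + (W⁄L).a₃ with hudef
  set r := x' ^ 3 + (W⁄L).a₂ * x' ^ 2 + (W⁄L).a₄ * x' + (W⁄L).a₆ with hrdef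
  have hu : u ∈ S n := add_mem (mul_mem (algS n W.a₁) hx'S) (algS n W.a₃)
  have hr : r ∈ S n :=
    add_mem (add_mem (add_mem (pow_mem hx'S 3) (mul_mem (algS n W.a₂) (pow_mem hx'S 2)))
      (mul_mem (algS n W.a₄) hx'S)) (algS n W.a₆)
  rcases hp.eq_two_or_odd' with rfl | hodd
  · -- `p = 2`
    have huy : u * y' ∈ S n := by
      have : u * y' = r - y' ^ 2 := by rw [← hquad]; ring
      rw [this]
      exact sub_mem hr hy'p
    by_cases hu0 : u = 0
    · -- `pQ` has order `2`
      right
      have hny : (W⁄L).toAffine.negY x' y' = y' := by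
        have : (W⁄L).toAffine.negY x' y' = -y' - u := by rw [Affine.negY, hudef]; ring
        rw [this, hu0, sub_zero, CharTwo.neg_eq]
      have hneg : -Affine.Point.some x' y' h' = Affine.Point.some x' y' h' := by
        rw [Affine.Point.neg_some]
        simp only [hny]
      rw [show ((2 : ℕ) : ℤ) = 1 + 1 by norm_num, add_zsmul, one_zsmul]
      nth_rewrite 2 [← hneg]
      exact add_neg_cancel _
    · left
      have hmem : y' ∈ S n := by
        rw [show y' = u * y' / u by rw [mul_div_cancel_left₀ _ hu0]]
        exact div_mem huy hu
      exact (memS n y').mp hmem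
  · -- `p` odd: complete the square
    left
    have h2 : (2 : L) ≠ 0 := by
      intro h2
      have hdvd : p ∣ 2 := (CharP.cast_eq_zero_iff L p 2).mp (by exact_mod_cast h2)
      have hp2 : p ≤ 2 := Nat.le_of_dvd two_pos hdvd
      have := hp.two_le
      obtain ⟨k, hk⟩ := hodd
      omega
    have h2S : (2 : L) ∈ S n := by simpa only [map_ofNat] using algS n (2 : K)
    have h4S : (4 : L) ∈ S n := by simpa only [map_ofNat] using algS n (4 : K)
    set w := y' + u / 2 with hw
    have hw2 : w ^ 2 ∈ S n := by
      have h4 : (4 : L) ≠ 0 := by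
        rw [show (4 : L) = 2 * 2 by norm_num]
        exact mul_ne_zero h2 h2
      have : w ^ 2 = r + u ^ 2 / 4 := by
        rw [hw, ← hquad]
        field_simp
        ring
      rw [this]
      exact add_mem hr (div_mem (pow_mem hu 2) h4S)
    have hwp : w ^ p ∈ S n := by
      rw [hw, add_pow_char]
      exact add_mem hy'p (pow_mem (div_mem hu h2S) p)
    have hwS : w ∈ S n := mem_of_sq_mem_of_pow_mem (S n) hodd hw2 hwp
    have hy' : y' = w - u / 2 := by rw [hw, add_sub_cancel_right]
    exact (memS n y').mp (by rw [hy']; exact sub_mem hwS (div_mem hu h2S))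

/-- **Points with `p^n`-th powers of coordinates in `K` are `p`-power torsion modulo `E(K)`.**
If `Q = (x, y) ∈ E(L)` has `x^{p^n}, y^{p^n} ∈ K` (`char K = p`, `L ⊇ K`), then `p^m Q ∈ E(K)`
(the image of `E(K) → E(L)`) for some `m` — induction on `n` with `zsmul_expChar_descends`.
[cite: SilvermanAEC2009, Cor. II.2.12 and Cor. III.5.5] -/
theorem exists_pow_smul_eq_map_of_pow_mem {p : ℕ} (hp : p.Prime) [CharP K p] (L : Type u)
    [Field L] [Algebra K L] (n : ℕ) {x y : L} (h : (W⁄L).toAffine.Nonsingular x y)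
    (hx : ∃ k : K, algebraMap K L k = x ^ p ^ n) (hy : ∃ k : K, algebraMap K L k = y ^ p ^ n) :
    ∃ (m : ℕ) (P : W.toAffine.Point),
      (p ^ m : ℤ) • Affine.Point.some x y h = Affine.Point.baseChange (W' := W) K L P := by
  induction n generalizing x y with
  | zero =>
    obtain ⟨x₀, hx₀⟩ := hx
    obtain ⟨y₀, hy₀⟩ := hy
    rw [pow_zero, pow_one] at hx₀ hy₀
    subst hx₀ hy₀
    have h₀ : W.toAffine.Nonsingular x₀ y₀ :=
      (Affine.baseChange_nonsingular (W := W) (f := Algebra.ofId K L)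
        (algebraMap K L).injective x₀ y₀).mp h
    exact ⟨0, Affine.Point.some x₀ y₀ h₀, by rw [pow_zero, one_zsmul]; rfl⟩
  | succ n ih =>
    rcases zsmul_expChar_descends W hp L n h hx hy with h0 | ⟨x', y', h', e, hx', hy' | h0'⟩
    · exact ⟨1, 0, by rw [pow_one, h0]; rfl⟩
    · obtain ⟨m, P, hm⟩ := ih h' hx' hy'
      exact ⟨m + 1, P, by rw [pow_succ, mul_zsmul, e, hm]⟩
    · exact ⟨2, 0, by rw [pow_two, mul_zsmul, e, h0']; rfl⟩

/-- An element of `K̄` fixed by every `K`-automorphism is purely inseparable over `K` (its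
minimal polynomial has a single root, `K̄/K` being normal). The tree has this as
`mem_perfectClosure_of_forall_algEquiv_apply_eq` (namespace
`Literature.NumberTheory.EllipticCurves.FunctionField`, `FunctionFieldUnramifiedProofs`);
re-proved to keep this file below the function-field hierarchy. Milne, *Fields and Galois
Theory*, Ch. 7. [folklore] -/
private theorem mem_perfectClosure_of_forall_apply_eq {x : AlgebraicClosure K}
    (hx : ∀ σ : AlgebraicClosure K ≃ₐ[K] AlgebraicClosure K, σ x = x) :
    x ∈ perfectClosure K (AlgebraicClosure K) := by
  have hint : _root_.IsIntegral K x := Algebra.IsIntegral.isIntegral x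
  rw [mem_perfectClosure_iff_natSepDegree_eq_one,
    Polynomial.natSepDegree_eq_of_isAlgClosed (AlgebraicClosure K)]
  have hroots : ((minpoly K x).aroots (AlgebraicClosure K)).toFinset = {x} := by
    ext z
    simp only [Multiset.mem_toFinset, Finset.mem_singleton]
    constructor
    · intro hz
      rw [Polynomial.mem_aroots] at hz
      have hmin : minpoly K x = minpoly K z :=
        minpoly.eq_of_irreducible_of_monic (minpoly.irreducible hint) hz.2 (minpoly.monic hint)
      obtain ⟨σ, hσ⟩ := (Normal.minpoly_eq_iff_mem_orbit (F := K) (AlgebraicClosure K)).mp hmin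
      change σ z = x at hσ
      calc z = σ.symm (σ z) := (σ.symm_apply_apply z).symm
        _ = σ.symm x := by rw [hσ]
        _ = x := hx σ.symm
    · intro hzx
      rw [hzx, Polynomial.mem_aroots]
      exact ⟨minpoly.ne_zero hint, minpoly.aeval K x⟩
  rw [hroots, Finset.card_singleton]

/-- Monotonicity of "`z^{p^a} ∈ K`" in the exponent. [folklore] -/
private theorem exists_algebraMap_eq_pow_of_le {p : ℕ} {z : AlgebraicClosure K} {a b : ℕ}
    (hab : a ≤ b) (hz : ∃ k : K, algebraMap K (AlgebraicClosure K) k = z ^ p ^ a) :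
    ∃ k : K, algebraMap K (AlgebraicClosure K) k = z ^ p ^ b := by
  obtain ⟨k, hk⟩ := hz
  refine ⟨k ^ p ^ (b - a), ?_⟩
  rw [map_pow, hk, ← pow_mul, ← pow_add, Nat.add_sub_cancel' hab]

/-- **Galois descent up to `p`-power torsion, over an arbitrary field.** Let `E` be an elliptic
curve over a field `K` of exponential characteristic `p` and let `Q ∈ E(K̄)` be fixed by
`Γ_K = Aut(K̄/K)`. Then `p^m Q ∈ E(K)` for some `m` (with `m = 0` when `K` is perfect, the tree's
`exists_toGeomPoints_eq_of_forall_smul_eq`). The coordinates of `Q` are `Γ_K`-fixed, hence in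
the perfect closure of `K` (`K̄^{Aut(K̄/K)} = K^{perf}`), i.e. have `p^n`-th powers in `K`, and
`exists_pow_smul_eq_map_of_pow_mem` applies. Equivalently: `E(K̄)^{Γ_K}/E(K)` is a
`p`-primary torsion group. Silverman, *AEC*, VIII.§1 treats `K` perfect (`E(K̄)^{G} = E(K)`);
the general case rests on the inseparability of `[p]` (Cor. III.5.5, proof of Thm. III.6.1).
[cite: SilvermanAEC2009, VIII.§1 and Cor. III.5.5] -/
theorem exists_pow_expChar_smul_eq_toGeomPoints_of_forall_smul_eq (p : ℕ) [ExpChar K p]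
    {Q : geomPoints W} (hQ : ∀ σ : Field.absoluteGaloisGroup K, σ • Q = Q) :
    ∃ (m : ℕ) (P : W.toAffine.Point), (p ^ m : ℤ) • Q = toGeomPoints W P := by
  rcases ‹ExpChar K p› with _ | ⟨hp⟩
  · obtain ⟨P, hP⟩ := exists_toGeomPoints_eq_of_forall_smul_eq W hQ
    exact ⟨0, P, by rw [pow_zero, one_zsmul, hP]⟩
  · induction Q using WeierstrassCurve.Affine.Point.rec with
    | zero => exact ⟨0, 0, by rw [map_zero]; exact zsmul_zero _⟩
    | some x y h =>
      have hxy : ∀ σ : AlgebraicClosure K ≃ₐ[K] AlgebraicClosure K, σ x = x ∧ σ y = y := by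
        intro σ
        have e := hQ σ
        change Affine.Point.map (σ : AlgebraicClosure K →ₐ[K] AlgebraicClosure K)
          (Affine.Point.some x y h) = Affine.Point.some x y h at e
        rw [Affine.Point.map_some] at e
        simpa only [Affine.Point.some.injEq, AlgEquiv.coe_toAlgHom] using e
      have hp' : ringExpChar K = p := ringExpChar.eq K p
      obtain ⟨n₁, hn₁⟩ := (mem_perfectClosure_iff_pow_mem p).mp
        (mem_perfectClosure_of_forall_apply_eq fun σ => (hxy σ).1)
      obtain ⟨n₂, hn₂⟩ := (mem_perfectClosure_iff_pow_mem p).mp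
        (mem_perfectClosure_of_forall_apply_eq fun σ => (hxy σ).2)
      obtain ⟨kx, hkx⟩ := RingHom.mem_range.mp hn₁
      obtain ⟨ky, hky⟩ := RingHom.mem_range.mp hn₂
      exact exists_pow_smul_eq_map_of_pow_mem W hp (AlgebraicClosure K) (max n₁ n₂) h
        (exists_algebraMap_eq_pow_of_le (le_max_left _ _) ⟨kx, hkx⟩)
        (exists_algebraMap_eq_pow_of_le (le_max_right _ _) ⟨ky, hky⟩)

/-! ## Consequences for `n` invertible in `K`: descent and the Kummer sequence -/

/-- For `n` invertible in `K` (i.e. prime to the exponential characteristic `p`), `n` and every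
`p^m` are coprime integers. [folklore] -/
private theorem isCoprime_pow_expChar (p : ℕ) [ExpChar K p] {n : ℤ} (hn : (n : K) ≠ 0) (m : ℕ) :
    IsCoprime ((p : ℤ) ^ m) n := by
  rcases ‹ExpChar K p› with _ | ⟨hp⟩
  · rw [Nat.cast_one, one_pow]
    exact isCoprime_one_left
  · have hpn : ¬ (p : ℤ) ∣ n := fun h => hn ((CharP.intCast_eq_zero_iff K p n).mpr h)
    exact IsCoprime.pow_left
      ((Nat.prime_iff_prime_int.mp hp).irreducible.coprime_iff_not_dvd.mpr hpn)

/-- **Galois descent for points with a rational multiple of order prime to `p`.** Over any field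
`K`, a `Γ_K`-fixed point `Q ∈ E(K̄)` some multiple `nQ` of which is rational, with `n` invertible
in `K`, is itself rational: `p^m Q ∈ E(K)` by
`exists_pow_expChar_smul_eq_toGeomPoints_of_forall_smul_eq` and `a p^m + b n = 1`. (For `K`
perfect every fixed point is rational, Silverman *AEC* VIII.§1; this is the substitute used by
the Kummer sequence for `n` prime to `char K`, Milne *ADT* I.§6.)
[cite: SilvermanAEC2009, VIII.§1 and Cor. III.5.5] -/
theorem exists_toGeomPoints_eq_of_forall_smul_eq_of_zsmul_eq {n : ℤ} (hn : (n : K) ≠ 0)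
    {Q : geomPoints W} (hQ : ∀ σ : Field.absoluteGaloisGroup K, σ • Q = Q)
    {P₁ : W.toAffine.Point} (hP₁ : n • Q = toGeomPoints W P₁) :
    ∃ P : W.toAffine.Point, toGeomPoints W P = Q := by
  obtain ⟨p, hp⟩ := ExpChar.exists K
  obtain ⟨m, P₂, hm⟩ := exists_pow_expChar_smul_eq_toGeomPoints_of_forall_smul_eq W p hQ
  obtain ⟨a, b, hab⟩ := isCoprime_pow_expChar (K := K) p hn m
  refine ⟨a • P₂ + b • P₁, ?_⟩
  rw [map_add, map_zsmul, map_zsmul, ← hm, ← hP₁, ← mul_smul, ← mul_smul, ← add_smul, hab,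
    one_smul]

/-! ## The Kummer sequence for `n` invertible in `K` -/

section KummerMap

variable (n : ℤ) (hdiv : ∀ P : geomPoints W, ∃ Q : geomPoints W, n • Q = P)

/-- **Kernel of the Kummer map over an arbitrary field**: for `n` invertible in `K`,
`κ P = 0 ↔ P ∈ nE(K)` — the tree's `kummerMapTorsion_ker` without `[PerfectField K]`, the descent
step being `exists_toGeomPoints_eq_of_forall_smul_eq_of_zsmul_eq`. Silverman, *AEC*, VIII.§2
(exactness of the Kummer sequence at `E(K)/mE(K)`); Milne, *ADT*, I.§6 (global fields of any
characteristic, `m` prime to `char K`). [cite: SilvermanAEC2009, VIII.§2] -/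
theorem kummerMapTorsion_ker_of_ne_zero (hn : (n : K) ≠ 0) :
    (kummerMapTorsion W n hdiv).ker = (zsmulAddGroupHom (α := W.toAffine.Point) n).range := by
  ext P
  rw [AddMonoidHom.mem_ker, AddMonoidHom.mem_range, kummerMapTorsion_apply, kummerMapTorsionFun,
    kummerClassTorsion_eq_zero_iff]
  constructor
  · rintro ⟨T, hT, hfixT⟩
    have hnQT : n • (zsmulRoot W n hdiv P - T) = toGeomPoints W P := by
      rw [zsmul_sub, zsmul_zsmulRoot, (mem_geomTorsion_iff W n T).mp hT, sub_zero]
    obtain ⟨R, hR⟩ := exists_toGeomPoints_eq_of_forall_smul_eq_of_zsmul_eq W hn hfixT hnQT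
    refine ⟨R, toGeomPoints_injective W ?_⟩
    change toGeomPoints W (n • R) = toGeomPoints W P
    rw [map_zsmul, hR, hnQT]
  · rintro ⟨R, rfl⟩
    refine ⟨zsmulRoot W n hdiv (zsmulAddGroupHom n R) - toGeomPoints W R, ?_, ?_⟩
    · rw [mem_geomTorsion_iff, zsmul_sub, zsmul_zsmulRoot, ← map_zsmul, sub_eq_zero]
      rfl
    · rw [sub_sub_cancel]
      exact toGeomPoints_mem_fixedPoints W R

/-- **Exactness of the Kummer sequence at `H¹(K, E[n])` over an arbitrary field**: for `n`
invertible in `K`, a class killed by `H¹(K, E[n]) → H¹(K, E)` is in the image of the Kummer map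
— the tree's `mem_range_kummerMapTorsion_of_torsionH1ToH1_eq_zero` without `[PerfectField K]`.
If `[f] ↦ 0` then `f σ = σ • Q - Q` with `nQ` fixed by `Γ_K`; by
`exists_pow_expChar_smul_eq_toGeomPoints_of_forall_smul_eq` some `p^m (nQ)` is rational, and
with `a p^m + b n = 1` the point `Q' = a p^m Q` has `nQ'` rational and Kummer class
`a p^m [f] = [f] - b (n [f]) = [f]` (`H¹(K, E[n])` is killed by `n`). Silverman, *AEC*, VIII.§2;
Milne, *ADT*, I.§6. [cite: SilvermanAEC2009, VIII.§2] -/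
theorem mem_range_kummerMapTorsion_of_torsionH1ToH1_eq_zero_of_ne_zero (hn : (n : K) ≠ 0)
    (ξ : galH1Torsion W n) (hξ : torsionH1ToH1 W n ξ = 0) :
    ξ ∈ (kummerMapTorsion W n hdiv).range := by
  obtain ⟨p, hp⟩ := ExpChar.exists K
  obtain ⟨f, rfl⟩ := oneCocycleClass_surjective _ ξ
  unfold torsionH1ToH1 at hξ
  simp only [LinearMap.toAddMonoidHom_coe, ContinuousLinearMap.coe_coe] at hξ
  rw [map_oneCocycleClass, oneCocycleClass_eq_zero_iff] at hξ
  obtain ⟨Q, hQ⟩ := hξ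
  have hf : ∀ σ, ((f.1 σ : geomTorsion W n) : geomPoints W) = σ • Q - Q := hQ
  have hnQ : n • Q ∈ MulAction.fixedPoints (Field.absoluteGaloisGroup K) (geomPoints W) := by
    intro σ
    rw [smul_zsmul_geomPoints, ← sub_eq_zero, ← zsmul_sub, ← hf σ]
    exact (mem_geomTorsion_iff W n _).mp (f.1 σ).2
  obtain ⟨m, P₂, hm⟩ := exists_pow_expChar_smul_eq_toGeomPoints_of_forall_smul_eq W p hnQ
  obtain ⟨a, b, hab⟩ := isCoprime_pow_expChar (K := K) p hn m
  set c : ℤ := a * (p : ℤ) ^ m with hc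
  have hcQ : n • (c • Q) = toGeomPoints W (a • P₂) := by
    rw [smul_smul, mul_comm, ← smul_smul, hc, mul_smul, hm, map_zsmul]
  refine ⟨a • P₂, ?_⟩
  rw [kummerMapTorsion_apply, kummerMapTorsionFun_eq W n hdiv (a • P₂) (c • Q) hcQ]
  have hA : kummerClassTorsion W n (c • Q)
      (by rw [hcQ]; exact toGeomPoints_mem_fixedPoints W _) = oneCocycleClass _ (c • f) := by
    unfold kummerClassTorsion
    congr 1
    apply Subtype.ext
    ext σ : 1
    apply Subtype.ext
    rw [coe_kummerCocycleTorsion_apply]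
    change σ • (c • Q) - c • Q = (((c • f.1) σ : geomTorsion W n) : geomPoints W)
    rw [ContinuousMap.smul_apply, AddSubgroupClass.coe_zsmul, hf σ, smul_zsmul_geomPoints,
      zsmul_sub]
  -- `c • f = f`, since `c ≡ 1 (mod n)` and `f` has values in `E[n]`
  have hc1 : c = 1 - b * n := by rw [hc, ← hab]; ring
  have hcf : c • f = f := by
    apply Subtype.ext
    ext σ : 1
    apply Subtype.ext
    change (((c • f.1) σ : geomTorsion W n) : geomPoints W) =
      ((f.1 σ : geomTorsion W n) : geomPoints W)
    have hnv : n • ((f.1 σ : geomTorsion W n) : geomPoints W) = 0 :=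
      (mem_geomTorsion_iff W n _).mp (f.1 σ).2
    rw [ContinuousMap.smul_apply, AddSubgroupClass.coe_zsmul, hc1, sub_zsmul, one_zsmul, mul_zsmul,
      hnv, zsmul_zero]
    abel
  rw [hA, hcf]

end KummerMap

end Descent

end WeierstrassCurve

end
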